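import Summits.BirchSwinnertonDyer.BirchSwinnertonDyer.Theorems.AlignedTransportAtTwoMainConjectureOfRankZeroBSDAtTwoFineRoadNecessitySpread
import Summits.BirchSwinnertonDyer.BirchSwinnertonDyer.Theorems.AlignedTransportAtTwoMainConjectureOfRankZeroBSDAtTwoFineRoadStrictPerfectDescent
import HarnessLib

/-!
# NECESSITY SPREAD, both signs of `Δ_W`: MC₂(W) — hence the crux C2 with BSD₂(W) — forces the finiteness of the STRICT fine Selmer
# group `Sel₀(ℚ_∞, W′[2])` and of the WIDE `G_∞`-invariant part upstairs for EVERY `W′/ℚ` with `W′[2] ≅ W[2]`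

Cell `bsd-f1-sign2`, WIDTH-5 attach seat `bsd-line-att-p5` (gen 6) on line `birth` of crux C2
stmt-BirchSwinnertonDyer-22298 `MainConjectureOfRankZeroBSDAtTwo`; the sign-free companion of `…FineRoadNecessitySpread` (which, on
`Δ_W < 0`, spreads the full statement (A)₂^{rel ∞} in `E[2^∞]`-currency). For `Δ_W > 0` the passage back from `W′[2]`- to
`W′[2^∞]`-coefficients is blocked by the archimedean local kernels (att-p5 g5 audit of PERFECT-DESCENT §3 (v)), so here the spread
is stated in the currency where it holds for both signs: Greenberg's STRICT fine Selmer group of the `2`-TORSION module over `ℚ_∞`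
and, upstairs over `F_∞ = ℚ_∞(W′[2])`, its `Gal(ℚ̄/ℚ_∞)`-invariant part (att-p5 g5 `StrictPerfectDescent`). A `--supports 22298
--as helper` file. HONEST FRAMING: THEOREMS ONLY — no definition, no named fact of mine, no `sorry`; CONDITIONAL on the displayed
PRINT facts (`hper`, `hmod`) and on MC₂(W) resp. the crux `hC2`; C2-neutral (closes nothing); BSD is NOT proved by any of this.

* `finite_fineSelmerInfty_twoCoeff_of_mazurMainConjecture_two_of_torsionIso` — MC₂(W) (seed-cell-shaped `W`, EITHER sign of `Δ_W`)
  ⟹ `Sel₀(ℚ_∞, W′[2])` finite for every `W′/ℚ` with `W[2] ≅ W′[2]` `Γ_ℚ`-equivariantly and every normalised cyclotomic datum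
  (necessity ⟹ (A)₂(W) ⟹ `Sel₀(ℚ_∞, W[2])` finite (Literature `finite_fineSelmerInfty_torsion_of_finite_pTorsion`) ⟹ transport
  along the module isomorphism (Literature `finite_fineSelmerInfty_iff_of_addEquiv`)).
* `finite_invariants_strict_of_mazurMainConjecture_two_of_torsionIso` — hence the `Gal(ℚ̄/ℚ_∞)`-invariant part of the strict
  `Sel₀(ℚ_∞(W′[2]); W′[2])` is finite (`StrictPerfectDescent.finite_strictFine_twoCoeff_iff_finite_invariants`): the necessity
  chain's door-free endpoint, now for the whole `E[2]`-class of the cell curve.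
* the same FROM THE CRUX BY NAME, and for `ℚ(W′[2]) = ℚ(W[2])` (so for twist models, odd isogenies, equal splitting fields of the
  `2`-division cubics via `…QuadraticTwist` / `…OddIsogeny` / `…DivisionCubic`).

References: J. Coates, R. Sujatha, Math. Ann. 331 (2005) §3 (statement (A)); M. F. Lim, R. Sujatha, J. Number Theory 187 (2018) §3
(proof of Prop. 3.2); R. Greenberg, LNM 1716 (1999) §1 Conj. 1.11, §3; the lead's PERFECT-DESCENT.md §1 (necessity corollary).
-/

set_option linter.dupNamespace false
set_option autoImplicit false

noncomputable section

open scoped Classical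

open CongruenceSubgroup WeierstrassCurve Field Literature.NumberTheory.EllipticCurves
  Literature.NumberTheory.EllipticCurves.GreenbergSelmer Literature.NumberTheory.GaloisRepresentations
  Literature.NumberTheory.EllipticCurves.FineSelmerCoefficientMap
  Literature.NumberTheory.EllipticCurves.ModularForms
  Literature.NumberTheory.EllipticCurves.Rank1Residual
  Literature.NumberTheory.EllipticCurves.Greenberg1999
  Literature.NumberTheory.EllipticCurves.IwasawaModuleFinitePadicInt
  Literature.NumberTheory.IwasawaTheory
  Summit.BirchSwinnertonDyer.Rank1Residual
  Summit.BirchSwinnertonDyer.Rank1Residual.X1.MuLambda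
  Summit.BirchSwinnertonDyer.Rank1Residual.X5
  Summit.BirchSwinnertonDyer.Rank1Residual.F1Sign2
  Summit.BirchSwinnertonDyer.BirchSwinnertonDyer.Theorems.Rank1ResidualX1Defs
  Summit.BirchSwinnertonDyer.BirchSwinnertonDyer.Theses.AlignedTransportAtTwo
  Summit.BirchSwinnertonDyer.BirchSwinnertonDyer.Theorems.AlignedTransportAtTwoMuNecessity
  Summit.BirchSwinnertonDyer.BirchSwinnertonDyer.Theorems.AlignedTransportAtTwoFineRoad

namespace Summit.BirchSwinnertonDyer.BirchSwinnertonDyer.Theorems.AlignedTransportAtTwoFineRoad.NecessitySpreadWide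

variable (W : WeierstrassCurve ℚ) [W.IsElliptic] [W.IsGloballyMinimal] (W' : WeierstrassCurve ℚ) [W'.IsElliptic]

/-! ## §1 From MC₂(W), either sign of `Δ_W` -/

omit [W'.IsElliptic] in
/-- **MC₂(W) ⟹ `Sel₀(ℚ_∞, W′[2])` finite for every `W′/ℚ` with `W[2] ≅ W′[2]` equivariantly** (seed-cell-shaped `W`, EITHER sign of
`Δ_W`; PRINT `hper`, `hmod`; every normalised cyclotomic datum). Conditional on MC₂(W); nothing else asserted.
[cite: CoatesSujatha2005, §3 (statement (A))] [cite: LimSujatha2018, §3 (proof of Prop. 3.2)] -/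
theorem finite_fineSelmerInfty_twoCoeff_of_mazurMainConjecture_two_of_torsionIso
    (hper : realPeriodRat_eq_unit_mul_plusPeriod_two) (hmod : nonempty_modularParametrizationData) (hord : IsOrdinaryAt W 2)
    (ht : ∀ x : ℚ, ¬ HasRationalTwoTorsionX W x)
    (hμan : ∀ ⦃N : ℕ⦄ [NeZero N] (f : CuspForm (Gamma0 N) 2), IsNewformOf W f →
      ∀ G : IwasawaAlgebra 2, IsEvenBranchLiftAtTwo W f G → red G ≠ 0)
    (hMC : MazurMainConjecture W 2)
    (e : W.geomTorsion 2 ≃+ W'.geomTorsion 2) (he : ∀ (σ : absoluteGaloisGroup ℚ) (P : W.geomTorsion 2), e (σ • P) = σ • e P)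
    (κ : ZpExtension ℚ 2) (γ : absoluteGaloisGroup ℚ) (hκ : κ.IsCyclotomic) (hγ : κ.IsTopGenerator γ)
    (hγ' : IsCyclotomicVariable 2 γ) :
    (fineSelmerInfty (↥(W'.geomTorsion 2)) κ : Set (subgroupH1 κ.kerSubgroup (W'.geomTorsion 2))).Finite := by
  have hA : Set.Finite {s : W.fineSelmerInfty κ | 2 • s = 0} :=
    finite_twoTorsion_fineSelmer_of_mazurMainConjecture_two W hper hmod hord ht hμan hMC κ γ hκ hγ hγ'
  have h1 : (fineSelmerInfty (↥(W.geomTorsion 2)) κ : Set (subgroupH1 κ.kerSubgroup (W.geomTorsion 2))).Finite :=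
    finite_fineSelmerInfty_torsion_of_finite_pTorsion W κ hA
  exact (finite_fineSelmerInfty_iff_of_addEquiv κ e he).mp h1

/-- **MC₂(W) ⟹ the `Gal(ℚ̄/ℚ_∞)`-invariant part of the strict `Sel₀(ℚ_∞(W′[2]); W′[2])` is finite** for every `W′/ℚ` with
`W[2] ≅ W′[2]` equivariantly (either sign of `Δ_W`): §1 followed by att-p5 g5's
`StrictPerfectDescent.finite_strictFine_twoCoeff_iff_finite_invariants` for `W′` — the necessity chain's door-free endpoint (wide
`G_∞`-equivariant homomorphisms `Gal(ℚ̄/ℚ_∞(W′[2])) → W′[2]` killing every decomposition group) for the whole `E[2]`-class of `W`.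
[cite: CoatesSujatha2005, §3 (statement (A))] [cite: SerreGaloisCohomology1997, I §2.6] -/
theorem finite_invariants_strict_of_mazurMainConjecture_two_of_torsionIso
    (hper : realPeriodRat_eq_unit_mul_plusPeriod_two) (hmod : nonempty_modularParametrizationData) (hord : IsOrdinaryAt W 2)
    (ht : ∀ x : ℚ, ¬ HasRationalTwoTorsionX W x)
    (hμan : ∀ ⦃N : ℕ⦄ [NeZero N] (f : CuspForm (Gamma0 N) 2), IsNewformOf W f →
      ∀ G : IwasawaAlgebra 2, IsEvenBranchLiftAtTwo W f G → red G ≠ 0)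
    (hMC : MazurMainConjecture W 2)
    (e : W.geomTorsion 2 ≃+ W'.geomTorsion 2) (he : ∀ (σ : absoluteGaloisGroup ℚ) (P : W.geomTorsion 2), e (σ • P) = σ • e P)
    (κ : ZpExtension ℚ 2) (γ : absoluteGaloisGroup ℚ) (hκ : κ.IsCyclotomic) (hγ : κ.IsTopGenerator γ)
    (hγ' : IsCyclotomicVariable 2 γ) :
    Set.Finite {x : subgroupH1 (κ.kerSubgroup ⊓ (W'.galoisRepTorsion 2).ker) (W'.geomTorsion 2) |
      x ∈ strictSelmerGroupOver (κ.kerSubgroup ⊓ (W'.galoisRepTorsion 2).ker) (W'.geomTorsion 2) 2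
          (fineData (W'.geomTorsion 2) 2) ∧
        ∀ g ∈ κ.kerSubgroup, conjH1 (κ.kerSubgroup ⊓ (W'.galoisRepTorsion 2).ker) (W'.geomTorsion 2) g x = x} :=
  (StrictPerfectDescent.finite_strictFine_twoCoeff_iff_finite_invariants W' κ).1
    (finite_fineSelmerInfty_twoCoeff_of_mazurMainConjecture_two_of_torsionIso W W' hper hmod hord ht hμan hMC e he κ γ hκ hγ hγ')

/-- **MC₂(W) ⟹ `Sel₀(ℚ_∞, W′[2])` finite whenever `ℚ(W′[2]) = ℚ(W[2])`** (either sign; so for every model of every quadratic twist,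
every odd-isogenous curve, every curve whose `2`-division cubic has the same splitting field — `…QuadraticTwist`, `…OddIsogeny`,
`…DivisionCubic`). [cite: Serre1972, §5.3] [cite: LimSujatha2018, §3 (proof of Prop. 3.2)] -/
theorem finite_fineSelmerInfty_twoCoeff_of_mazurMainConjecture_two_of_divisionField_eq
    (hper : realPeriodRat_eq_unit_mul_plusPeriod_two) (hmod : nonempty_modularParametrizationData) (hord : IsOrdinaryAt W 2)
    (ht : ∀ x : ℚ, ¬ HasRationalTwoTorsionX W x)
    (hμan : ∀ ⦃N : ℕ⦄ [NeZero N] (f : CuspForm (Gamma0 N) 2), IsNewformOf W f →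
      ∀ G : IwasawaAlgebra 2, IsEvenBranchLiftAtTwo W f G → red G ≠ 0)
    (hMC : MazurMainConjecture W 2) (hdiv : W.divisionField 2 = W'.divisionField 2)
    (κ : ZpExtension ℚ 2) (γ : absoluteGaloisGroup ℚ) (hκ : κ.IsCyclotomic) (hγ : κ.IsTopGenerator γ)
    (hγ' : IsCyclotomicVariable 2 γ) :
    (fineSelmerInfty (↥(W'.geomTorsion 2)) κ : Set (subgroupH1 κ.kerSubgroup (W'.geomTorsion 2))).Finite := by
  obtain ⟨e, he⟩ := DivisionFieldRigidity.exists_torsionIso_two_of_divisionField_eq W W' hdiv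
  exact finite_fineSelmerInfty_twoCoeff_of_mazurMainConjecture_two_of_torsionIso W W' hper hmod hord ht hμan hMC e he κ γ hκ hγ hγ'

/-! ## §2 From the crux `MainConjectureOfRankZeroBSDAtTwo` by name, either sign of `Δ_W` -/

omit [W'.IsElliptic] in
/-- **The crux BY NAME, seed-cell curve `W` with BSD₂(W), EITHER sign of `Δ_W` ⟹ `Sel₀(ℚ_∞, W′[2])` finite for every `W′/ℚ` with
`W[2] ≅ W′[2]` equivariantly** (PRINT `hper`, `hmod`). Conditional; BSD is not proved by any of this.
[cite: GreenbergLNM1716, §1 Conj. 1.11 (p. 58)] [cite: CoatesSujatha2005, §3 (statement (A))] -/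
theorem finite_fineSelmerInfty_twoCoeff_of_mainConjectureOfRankZeroBSDAtTwo_of_torsionIso
    (hper : realPeriodRat_eq_unit_mul_plusPeriod_two) (hmod : nonempty_modularParametrizationData)
    (hC2 : MainConjectureOfRankZeroBSDAtTwo) (hcm : ¬ W.HasCM) (hord : IsOrdinaryAt W 2)
    (ht : ∀ x : ℚ, ¬ HasRationalTwoTorsionX W x) (hsq : ¬ IsSquare W.Δ) (hr : W.analyticRank = 0)
    (hμan : ∀ ⦃N : ℕ⦄ [NeZero N] (f : CuspForm (Gamma0 N) 2), IsNewformOf W f →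
      ∀ G : IwasawaAlgebra 2, IsEvenBranchLiftAtTwo W f G → red G ≠ 0)
    (hbsd : BSDp W 2)
    (e : W.geomTorsion 2 ≃+ W'.geomTorsion 2) (he : ∀ (σ : absoluteGaloisGroup ℚ) (P : W.geomTorsion 2), e (σ • P) = σ • e P)
    (κ : ZpExtension ℚ 2) (γ : absoluteGaloisGroup ℚ) (hκ : κ.IsCyclotomic) (hγ : κ.IsTopGenerator γ)
    (hγ' : IsCyclotomicVariable 2 γ) :
    (fineSelmerInfty (↥(W'.geomTorsion 2)) κ : Set (subgroupH1 κ.kerSubgroup (W'.geomTorsion 2))).Finite :=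
  finite_fineSelmerInfty_twoCoeff_of_mazurMainConjecture_two_of_torsionIso W W' hper hmod hord ht hμan
    (hC2 W hcm hord ht hsq hr hμan hbsd) e he κ γ hκ hγ hγ'

/-- **The crux BY NAME ⟹ the wide `Gal(ℚ̄/ℚ_∞)`-invariant part of the strict `Sel₀(ℚ_∞(W′[2]); W′[2])` is finite** for every `W′`
in the `E[2]`-class of a seed-cell curve `W` with BSD₂(W) (either sign). [cite: GreenbergLNM1716, §1 Conj. 1.11 (p. 58)]
[cite: SerreGaloisCohomology1997, I §2.6] -/
theorem finite_invariants_strict_of_mainConjectureOfRankZeroBSDAtTwo_of_torsionIso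
    (hper : realPeriodRat_eq_unit_mul_plusPeriod_two) (hmod : nonempty_modularParametrizationData)
    (hC2 : MainConjectureOfRankZeroBSDAtTwo) (hcm : ¬ W.HasCM) (hord : IsOrdinaryAt W 2)
    (ht : ∀ x : ℚ, ¬ HasRationalTwoTorsionX W x) (hsq : ¬ IsSquare W.Δ) (hr : W.analyticRank = 0)
    (hμan : ∀ ⦃N : ℕ⦄ [NeZero N] (f : CuspForm (Gamma0 N) 2), IsNewformOf W f →
      ∀ G : IwasawaAlgebra 2, IsEvenBranchLiftAtTwo W f G → red G ≠ 0)
    (hbsd : BSDp W 2)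
    (e : W.geomTorsion 2 ≃+ W'.geomTorsion 2) (he : ∀ (σ : absoluteGaloisGroup ℚ) (P : W.geomTorsion 2), e (σ • P) = σ • e P)
    (κ : ZpExtension ℚ 2) (γ : absoluteGaloisGroup ℚ) (hκ : κ.IsCyclotomic) (hγ : κ.IsTopGenerator γ)
    (hγ' : IsCyclotomicVariable 2 γ) :
    Set.Finite {x : subgroupH1 (κ.kerSubgroup ⊓ (W'.galoisRepTorsion 2).ker) (W'.geomTorsion 2) |
      x ∈ strictSelmerGroupOver (κ.kerSubgroup ⊓ (W'.galoisRepTorsion 2).ker) (W'.geomTorsion 2) 2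
          (fineData (W'.geomTorsion 2) 2) ∧
        ∀ g ∈ κ.kerSubgroup, conjH1 (κ.kerSubgroup ⊓ (W'.galoisRepTorsion 2).ker) (W'.geomTorsion 2) g x = x} :=
  finite_invariants_strict_of_mazurMainConjecture_two_of_torsionIso W W' hper hmod hord ht hμan
    (hC2 W hcm hord ht hsq hr hμan hbsd) e he κ γ hκ hγ hγ'

/-- **The crux BY NAME ⟹ `Sel₀(ℚ_∞, W′[2])` finite whenever `ℚ(W′[2]) = ℚ(W[2])`** for a seed-cell curve `W` with BSD₂(W) (either
sign of `Δ_W`). [cite: Serre1972, §5.3] [cite: CoatesSujatha2005, §3 (statement (A))] -/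
theorem finite_fineSelmerInfty_twoCoeff_of_mainConjectureOfRankZeroBSDAtTwo_of_divisionField_eq
    (hper : realPeriodRat_eq_unit_mul_plusPeriod_two) (hmod : nonempty_modularParametrizationData)
    (hC2 : MainConjectureOfRankZeroBSDAtTwo) (hcm : ¬ W.HasCM) (hord : IsOrdinaryAt W 2)
    (ht : ∀ x : ℚ, ¬ HasRationalTwoTorsionX W x) (hsq : ¬ IsSquare W.Δ) (hr : W.analyticRank = 0)
    (hμan : ∀ ⦃N : ℕ⦄ [NeZero N] (f : CuspForm (Gamma0 N) 2), IsNewformOf W f →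
      ∀ G : IwasawaAlgebra 2, IsEvenBranchLiftAtTwo W f G → red G ≠ 0)
    (hbsd : BSDp W 2) (hdiv : W.divisionField 2 = W'.divisionField 2)
    (κ : ZpExtension ℚ 2) (γ : absoluteGaloisGroup ℚ) (hκ : κ.IsCyclotomic) (hγ : κ.IsTopGenerator γ)
    (hγ' : IsCyclotomicVariable 2 γ) :
    (fineSelmerInfty (↥(W'.geomTorsion 2)) κ : Set (subgroupH1 κ.kerSubgroup (W'.geomTorsion 2))).Finite :=
  finite_fineSelmerInfty_twoCoeff_of_mazurMainConjecture_two_of_divisionField_eq W W' hper hmod hord ht hμan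
    (hC2 W hcm hord ht hsq hr hμan hbsd) hdiv κ γ hκ hγ hγ'

end Summit.BirchSwinnertonDyer.BirchSwinnertonDyer.Theorems.AlignedTransportAtTwoFineRoad.NecessitySpreadWide

end
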